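import Summits.Ventures.CertifiedArithmetic.LowPrec.Sterbenz
import Summits.Ventures.CertifiedArithmetic.LowPrec.Monotone

/-!
# The error of a rounded addition is a value of the format; Fast2Sum recovers it (every format)

HONEST FRAMING (venture CertifiedArithmetic / cell `pub-lowprec`): certified error envelopes and
provably optimal rounding/accumulation schemes for low-precision formats under stated cost models;
every table by two implementations; no hardware or vendor claims.

For data `a, b` of ANY format `φ` of the venture (file `MiniFloat.lean`) and the saturating
round-to-nearest-even `fl = roundNE φ` (file `Round.lean`):
* `addErr_representable`: the addition error `a + b - fl(a + b)` is the value of a datum of `φ` —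
  the classical fact behind every error-free transformation [BoldoMelquiond2017, §5.1.3], here
  WITHOUT a no-overflow hypothesis: when `fl` saturates at `±maxRat` the error `|a + b| - maxRat`
  is still at most `min(|a|, |b|)` and a multiple of the smaller operand's ulp;
* `round_sub_representable`: if `|b| ≤ |a|` then `fl(a + b) - a` is a value of `φ`;
* FAST2SUM [Dekker1971; BoldoMelquiond2017, Thm 5.6 (Algorithm 5.1)]: with `|b| ≤ |a|`,
  `s = fl(a + b)`, `z = fl(s - a)`, `t = fl(b - z)` satisfy `z = s - a` and `t = a + b - s`
  EXACTLY (`fast2Sum_exact`), and the Neumaier/Kahan operation order `fl(fl(a - s) + b)` returns the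
  same error (`fast2Sum_exact'`). Again no range hypothesis: saturation is harmless for Fast2Sum in
  these formats (IEEE overflow-to-∞ is a different regime, cf. [BoldoGraillatMuller2017]).
Proofs are integer arithmetic on magnitudes in quanta (`Sterbenz.lean`): both
operands, `maxScaled`, and — the key step, `pow_dvd_toInt_roundNE` — the rounded sum are multiples
of `2^g` (`g = expCode b - 1`, the ulp exponent of the smaller operand), and the nearest property
against the candidate `a` bounds the error by `|b|`.
-/

namespace Literature.ComputerArithmetic.FloatingPoint

namespace MiniFloat

open Format

variable {φ : Format}

/-! ### Rounding of integer multiples of the quantum -/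

/-- `|fl x| = fl |x|` as values. [folklore] -/
theorem abs_toRat_roundNE (x : ℚ) : |(roundNE φ x).toRat| = (roundNE φ |x|).toRat := by
  rw [abs_toRat, scaledMag_roundNE, toRat_roundNE, abs_abs, if_neg (not_lt.mpr (abs_nonneg x))]

/-- A representable signed magnitude rounds to itself. [folklore] -/
theorem toInt_roundNE_of_representable {N : ℤ} (h : φ.Representable N.natAbs) :
    (roundNE φ ((N : ℚ) * φ.quantum)).toInt = N := by
  obtain ⟨y, hy⟩ := exists_toRat_eq_intCast_mul N h
  apply toInt_eq_of_toRat_eq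
  rw [← hy, toRat_roundNE_toRat]

/-- Saturation in quanta: `maxScaled < |N|` gives `|fl(N·q)| = maxScaled` quanta. [folklore] -/
theorem scaledMag_roundNE_of_maxScaled_lt {N : ℤ} (h : φ.maxScaled < N.natAbs) :
    (roundNE φ ((N : ℚ) * φ.quantum)).scaledMag = φ.maxScaled := by
  have hq := φ.quantum_pos
  have hN : (φ.maxScaled : ℚ) ≤ |(N : ℚ)| := by
    rw [← Int.cast_abs, ← Nat.cast_natAbs]; exact_mod_cast h.le
  have h1 : φ.maxRat ≤ |(N : ℚ) * φ.quantum| := by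
    unfold Format.maxRat; rw [abs_mul, abs_of_pos hq]
    exact mul_le_mul_of_nonneg_right hN hq.le
  have h2 := abs_toRat_roundNE_of_maxRat_le h1
  rw [abs_toRat] at h2
  unfold Format.maxRat at h2
  exact_mod_cast mul_right_cancel₀ (ne_of_gt hq) h2

/-- The signed magnitude of `fl(N·q)` carries the sign of `N`. [folklore] -/
theorem toInt_roundNE_intCast (N : ℤ) : (roundNE φ ((N : ℚ) * φ.quantum)).toInt =
    if N < 0 then -((roundNE φ ((N : ℚ) * φ.quantum)).scaledMag : ℤ)
    else ((roundNE φ ((N : ℚ) * φ.quantum)).scaledMag : ℤ) := by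
  have hq := φ.quantum_pos
  have hiff : ((N : ℚ) * φ.quantum < 0) ↔ N < 0 := by
    constructor
    · intro h
      by_contra hN
      exact absurd h (not_lt.mpr (mul_nonneg (by exact_mod_cast not_lt.mp hN) hq.le))
    · intro h; exact mul_neg_of_neg_of_pos (by exact_mod_cast h) hq
  unfold toInt
  simp only [neg_roundNE, decide_eq_true_eq]
  by_cases hN : N < 0
  · rw [if_pos (hiff.mpr hN), if_pos hN]
  · rw [if_neg (fun h => hN (hiff.mp h)), if_neg hN]

/-- Monotonicity in quanta: a representable magnitude `v ≤ |N|` is at most `|fl(N·q)|`.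
[folklore] -/
theorem le_scaledMag_roundNE_of_representable_le {v : ℕ} (hv : φ.Representable v) {N : ℤ}
    (hle : v ≤ N.natAbs) : v ≤ (roundNE φ ((N : ℚ) * φ.quantum)).scaledMag := by
  have hq := φ.quantum_pos
  obtain ⟨y, hy⟩ := exists_toRat_eq_intCast_mul (v : ℤ) (by simpa using hv)
  rw [Int.cast_natCast] at hy
  have h1 : (v : ℚ) * φ.quantum ≤ |(N : ℚ) * φ.quantum| := by
    rw [abs_mul, abs_of_pos hq, ← Int.cast_abs, ← Nat.cast_natAbs]
    apply mul_le_mul_of_nonneg_right _ hq.le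
    exact_mod_cast hle
  have hmono := toRat_roundNE_mono (φ := φ) h1
  rw [← hy, toRat_roundNE_toRat, hy, ← abs_toRat_roundNE, abs_toRat] at hmono
  have : (v : ℚ) ≤ ((roundNE φ ((N : ℚ) * φ.quantum)).scaledMag : ℚ) :=
    le_of_mul_le_mul_right hmono hq
  exact_mod_cast this

/-- A multiple of `2^g` within range that is NOT representable is at least `2^(p+g)` (`p = m+1`).
[folklore] -/
theorem pow_le_of_not_representable {g n : ℕ} (hd : 2 ^ g ∣ n) (hmax : n ≤ φ.maxScaled)
    (hn : ¬ φ.Representable n) : 2 ^ (φ.manBits + 1 + g) ≤ n := by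
  obtain ⟨c, rfl⟩ := hd
  by_contra hlt
  have hc : c < 2 ^ (φ.manBits + 1) := by
    by_contra hc
    apply hlt
    calc 2 ^ (φ.manBits + 1 + g) = 2 ^ g * 2 ^ (φ.manBits + 1) := by ring
      _ ≤ 2 ^ g * c := Nat.mul_le_mul_left _ (not_lt.mp hc)
  exact hn (by rw [mul_comm] at hmax ⊢; exact representable_mul_pow hc hmax)

/-- KEY DIVISIBILITY: if `2^g` divides the integer `N` and `maxScaled`, then it divides the signed
magnitude of `fl(N · quantum)` — whether `N` is representable (no rounding), beyond range
(saturation to `±maxScaled`), or rounded inside a binade of spacing `≥ 2^(g+1)`. [folklore] -/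
theorem pow_dvd_toInt_roundNE {g : ℕ} {N : ℤ} (hN : ((2 ^ g : ℕ) : ℤ) ∣ N)
    (hmax : 2 ^ g ∣ φ.maxScaled) : ((2 ^ g : ℕ) : ℤ) ∣ (roundNE φ ((N : ℚ) * φ.quantum)).toInt := by
  by_cases hrep : φ.Representable N.natAbs
  · rw [toInt_roundNE_of_representable hrep]; exact hN
  suffices h : 2 ^ g ∣ (roundNE φ ((N : ℚ) * φ.quantum)).scaledMag by
    rw [toInt_roundNE_intCast]
    split
    · exact dvd_neg.mpr (Int.natCast_dvd_natCast.mpr h)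
    · exact Int.natCast_dvd_natCast.mpr h
  rcases Nat.lt_or_ge φ.maxScaled N.natAbs with hbig | hsmall
  · rw [scaledMag_roundNE_of_maxScaled_lt hbig]; exact hmax
  · have hv := pow_le_of_not_representable (Int.natCast_dvd.mp hN) hsmall hrep
    have hv' : 2 ^ φ.manBits * 2 ^ (g + 1) ≤ N.natAbs := by
      calc 2 ^ φ.manBits * 2 ^ (g + 1) = 2 ^ (φ.manBits + 1 + g) := by ring
        _ ≤ N.natAbs := hv
    have hvrep : φ.Representable (2 ^ φ.manBits * 2 ^ (g + 1)) :=
      representable_mul_pow (by rw [pow_succ]; have := Nat.two_pow_pos φ.manBits; omega)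
        (le_trans hv' hsmall)
    have h1 := le_scaledMag_roundNE_of_representable_le hvrep hv'
    have h2 := Format.pow_dvd_of_representable
      (roundNE φ ((N : ℚ) * φ.quantum)).representable_scaledMag (s := g + 1) (by rw [pow_add]; exact h1)
    exact dvd_trans (Nat.pow_dvd_pow 2 (Nat.le_succ g)) h2

/-! ### The addition error is representable -/

/-- NEAREST PROPERTY IN QUANTA: the rounded sum is at least as close to the exact sum as the operand
`a`, i.e. `|A + B - S| ≤ |B|`. [folklore] -/
theorem natAbs_add_sub_round_le (a b : MiniFloat φ) :
    (a.toInt + b.toInt - (roundNE φ (a.toRat + b.toRat)).toInt).natAbs ≤ b.scaledMag := by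
  have hq := φ.quantum_pos
  set s := roundNE φ (a.toRat + b.toRat) with hs
  have h := roundNE_nearest (φ := φ) (a.toRat + b.toRat) a
  rw [← hs] at h
  have e1 : a.toRat + b.toRat - s.toRat = ((a.toInt + b.toInt - s.toInt : ℤ) : ℚ) * φ.quantum := by
    simp only [toRat_eq_toInt_mul]; push_cast; ring
  have e2 : a.toRat + b.toRat - a.toRat = ((b.toInt : ℤ) : ℚ) * φ.quantum := by
    simp only [toRat_eq_toInt_mul]; ring
  rw [e1, e2, abs_mul, abs_mul, abs_of_pos hq, ← Int.cast_abs, ← Nat.cast_natAbs, ← Int.cast_abs,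
    ← Nat.cast_natAbs] at h
  have h' : ((a.toInt + b.toInt - s.toInt).natAbs : ℚ) ≤ (b.toInt.natAbs : ℚ) :=
    le_of_mul_le_mul_right h hq
  rw [← natAbs_toInt b]
  exact_mod_cast h'

/-- THE ADDITION ERROR IS A VALUE OF THE FORMAT (every format, saturation included): for data
`a, b` there is a datum `e` with `e = a + b - fl(a + b)` exactly. [cite: BoldoMelquiond2017, §5.1.3] -/
theorem addErr_representable (a b : MiniFloat φ) :
    ∃ e : MiniFloat φ, e.toRat = a.toRat + b.toRat - (roundNE φ (a.toRat + b.toRat)).toRat := by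
  wlog hab : b.scaledMag ≤ a.scaledMag generalizing a b
  · obtain ⟨e, he⟩ := this b a (not_le.mp hab).le
    exact ⟨e, by rw [he, add_comm b.toRat a.toRat]⟩
  set s := roundNE φ (a.toRat + b.toRat) with hs
  have hgA : ((2 ^ (b.expCode - 1) : ℕ) : ℤ) ∣ a.toInt := pow_ulpExp_dvd_toInt hab
  have hgB : ((2 ^ (b.expCode - 1) : ℕ) : ℤ) ∣ b.toInt := pow_ulpExp_dvd_toInt le_rfl
  have hgS : ((2 ^ (b.expCode - 1) : ℕ) : ℤ) ∣ s.toInt := by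
    rw [hs, toRat_add_toRat]
    exact pow_dvd_toInt_roundNE (dvd_add hgA hgB) (pow_ulpExp_dvd_maxScaled b)
  have hT : ((2 ^ (b.expCode - 1) : ℕ) : ℤ) ∣ (a.toInt + b.toInt - s.toInt) :=
    dvd_sub (dvd_add hgA hgB) hgS
  obtain ⟨e, he⟩ := exists_toRat_eq_intCast_mul _
    (representable_natAbs_of_dvd_le b hT (natAbs_add_sub_round_le a b))
  exact ⟨e, by rw [he, toRat_eq_toInt_mul s, toRat_eq_toInt_mul a, toRat_eq_toInt_mul b]; push_cast; ring⟩

/-- The signed error `errAdd φ a b = fl(a+b) - (a+b)` of the tables is a value of `φ`. [folklore] -/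
theorem exists_toRat_eq_errAdd (a b : MiniFloat φ) : ∃ e : MiniFloat φ, e.toRat = errAdd φ a b := by
  obtain ⟨e, he⟩ := addErr_representable a b
  exact ⟨e.flipSign, by rw [toRat_flipSign, he]; unfold errAdd; ring⟩

/-! ### `fl(a + b) - a` is representable when `|b| ≤ |a|` -/

/-- Order of magnitudes from order of absolute values. [folklore] -/
theorem scaledMag_le_of_abs_le {a b : MiniFloat φ} (h : |b.toRat| ≤ |a.toRat|) :
    b.scaledMag ≤ a.scaledMag := by
  rw [abs_toRat, abs_toRat] at h
  exact_mod_cast le_of_mul_le_mul_right h φ.quantum_pos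

/-- The shift of a natural number seen through `⌊·⌋.toNat`. [folklore] -/
theorem shift_floor_natCast (n : ℕ) : φ.shift ⌊(n : ℚ)⌋.toNat = φ.shift n := by
  rw [Int.floor_natCast, Int.toNat_natCast]

/-- The binade of a magnitude `2^(m+e) ≤ n < 2^(m+1+e)` below the top has shift `e`. [folklore] -/
theorem shift_eq_of_bounds {n e : ℕ} (hlo : 2 ^ (φ.manBits + e) ≤ n)
    (hhi : n < 2 ^ (φ.manBits + 1 + e)) (he : e ≤ φ.emaxCode - 1) : φ.shift n = e := by
  apply le_antisymm
  · by_contra hlt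
    have hlt : e + 1 ≤ φ.shift n := by omega
    have h1 := Format.pow_shift_le (φ := φ) (n := n)
      (le_trans (Nat.pow_le_pow_right (by norm_num) (Nat.le_add_right _ _)) hlo)
    have h2 : 2 ^ (φ.manBits + 1 + e) ≤ 2 ^ (φ.manBits + φ.shift n) :=
      Nat.pow_le_pow_right (by norm_num) (by omega)
    omega
  · have := Format.shift_mono (φ := φ) hlo
    rwa [show 2 ^ (φ.manBits + e) = (2 ^ φ.manBits + 0) * 2 ^ e by ring,
      Format.shift_scaled_succ (Nat.two_pow_pos _) he] at this

/-- HALF-SPACING IN QUANTA: if `|N| ≤ maxScaled` lies in the binade `[2^(p+g), 2^(p+g+1))`, the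
rounded magnitude is within `2^g` of `|N|`. [folklore] -/
theorem natAbs_sub_scaledMag_roundNE_le {g : ℕ} {N : ℤ} (hlo : 2 ^ (φ.manBits + 1 + g) ≤ N.natAbs)
    (hhi : N.natAbs < 2 ^ (φ.manBits + 1 + (g + 1))) (hmax : N.natAbs ≤ φ.maxScaled) :
    ((N.natAbs : ℤ) - (roundNE φ ((N : ℚ) * φ.quantum)).scaledMag).natAbs ≤ 2 ^ g := by
  have hq := φ.quantum_pos
  -- the binade exponent g + 1 is below the top: maxScaled < 2^(m + emaxCode)
  have h1 : 1 ≤ φ.emaxCode := by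
    by_contra h0
    have := Format.maxScaled_eq_topMan (φ := φ) (by omega)
    have := φ.topMan_lt
    have : 2 ^ φ.manBits ≤ 2 ^ (φ.manBits + 1 + g) := Nat.pow_le_pow_right (by norm_num) (by omega)
    omega
  have he : g + 1 ≤ φ.emaxCode - 1 := by
    have hlt := lt_of_le_of_lt (le_trans hlo hmax) (Format.maxScaled_lt_pow h1)
    have := (Nat.pow_lt_pow_iff_right (by norm_num : 1 < 2)).mp hlt
    omega
  have hshift : φ.shift N.natAbs = g + 1 :=
    shift_eq_of_bounds (by rw [show φ.manBits + (g + 1) = φ.manBits + 1 + g by ring]; exact hlo) hhi he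
  have hr : (0 : ℚ) ≤ (N.natAbs : ℚ) := by positivity
  have hh := Format.abs_sub_rneGrid_le_half_spacing (φ := φ) hr (by exact_mod_cast hmax)
  rw [shift_floor_natCast, hshift, pow_succ, mul_div_cancel_right₀ _ (by norm_num : (2 : ℚ) ≠ 0)] at hh
  have hmag : (roundNE φ ((N : ℚ) * φ.quantum)).scaledMag = φ.rneGrid (N.natAbs : ℚ) := by
    rw [scaledMag_roundNE, abs_mul, abs_of_pos hq, mul_div_cancel_right₀ _ (ne_of_gt hq),
      Nat.cast_natAbs, Int.cast_abs]
  rw [hmag]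
  have : (((N.natAbs : ℤ) - (φ.rneGrid (N.natAbs : ℚ) : ℕ) : ℤ).natAbs : ℚ) ≤ (2 : ℚ) ^ g := by
    rw [Nat.cast_natAbs, Int.cast_abs, Int.cast_sub, Int.cast_natCast, Int.cast_natCast]; exact hh
  exact_mod_cast this

/-- `fl(a + b) - a` IS A VALUE OF THE FORMAT when `|b| ≤ |a|` (every format, saturation included).
[cite: BoldoMelquiond2017, §5.1.3] -/
theorem round_sub_representable (a b : MiniFloat φ) (hab : |b.toRat| ≤ |a.toRat|) :
    ∃ z : MiniFloat φ, z.toRat = (roundNE φ (a.toRat + b.toRat)).toRat - a.toRat := by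
  have hab' : b.scaledMag ≤ a.scaledMag := scaledMag_le_of_abs_le hab
  set s := roundNE φ (a.toRat + b.toRat) with hs
  set A := a.toInt with hA
  set B := b.toInt with hB
  set g := b.expCode - 1 with hg
  have hσ : a.toRat + b.toRat = ((A + B : ℤ) : ℚ) * φ.quantum := toRat_add_toRat a b
  have hsN : s = roundNE φ (((A + B : ℤ) : ℚ) * φ.quantum) := by rw [hs, hσ]
  have hXA : A.natAbs = a.scaledMag := natAbs_toInt a
  have hXB : B.natAbs = b.scaledMag := natAbs_toInt b
  have hAmax : a.scaledMag ≤ φ.maxScaled := a.scaledMag_le_maxScaled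
  have hSmax : s.scaledMag ≤ φ.maxScaled := s.scaledMag_le_maxScaled
  have hgA : ((2 ^ g : ℕ) : ℤ) ∣ A := pow_ulpExp_dvd_toInt hab'
  have hgB : ((2 ^ g : ℕ) : ℤ) ∣ B := pow_ulpExp_dvd_toInt le_rfl
  have hgM : 2 ^ g ∣ φ.maxScaled := pow_ulpExp_dvd_maxScaled b
  have hgS : ((2 ^ g : ℕ) : ℤ) ∣ s.toInt := by rw [hsN]; exact pow_dvd_toInt_roundNE (dvd_add hgA hgB) hgM
  have hnear : (A + B - s.toInt).natAbs ≤ b.scaledMag := natAbs_add_sub_round_le a b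
  have hsign : s.toInt = if A + B < 0 then -(s.scaledMag : ℤ) else (s.scaledMag : ℤ) := by
    rw [hsN]; exact toInt_roundNE_intCast (A + B)
  have hBlt : b.scaledMag < 2 ^ (φ.manBits + 1 + g) := scaledMag_lt_pow_ulpExp b
  -- the goal in quanta
  suffices hrep : φ.Representable (s.toInt - A).natAbs by
    obtain ⟨z, hz⟩ := exists_toRat_eq_intCast_mul _ hrep
    exact ⟨z, by rw [hz, toRat_eq_toInt_mul s, toRat_eq_toInt_mul a]; push_cast; ring⟩
  have hZdvd : ((2 ^ g : ℕ) : ℤ) ∣ (s.toInt - A) := dvd_sub hgS hgA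
  by_cases hrepN : φ.Representable (A + B).natAbs
  · -- Case I: no rounding error, `fl(a+b) - a = b`
    have : s.toInt = A + B := by rw [hsN]; exact toInt_roundNE_of_representable hrepN
    rw [this, show A + B - A = B by ring, hXB]
    exact b.representable_scaledMag
  rcases Nat.lt_or_ge φ.maxScaled (A + B).natAbs with hbig | hsmall
  · -- Case IIa: saturation; the operands have the same sign and |S - A| = maxScaled - |A| ≤ |B|
    have hM : s.scaledMag = φ.maxScaled := by rw [hsN]; exact scaledMag_roundNE_of_maxScaled_lt hbig
    refine representable_natAbs_of_dvd_le b hZdvd ?_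
    rw [hsign, hM]
    split <;> omega
  · -- Case IIb: |A + B| ≤ maxScaled not representable: |A + B| ≥ 2^(p+g), S is a multiple of 2^(g+1)
    have hv : 2 ^ (φ.manBits + 1 + g) ≤ (A + B).natAbs :=
      pow_le_of_not_representable (Int.natCast_dvd.mp (dvd_add hgA hgB)) hsmall hrepN
    have hv' : 2 ^ φ.manBits * 2 ^ (g + 1) ≤ (A + B).natAbs := by
      calc 2 ^ φ.manBits * 2 ^ (g + 1) = 2 ^ (φ.manBits + 1 + g) := by ring
        _ ≤ (A + B).natAbs := hv
    have hvrep : φ.Representable (2 ^ φ.manBits * 2 ^ (g + 1)) :=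
      representable_mul_pow (by rw [pow_succ]; have := Nat.two_pow_pos φ.manBits; omega)
        (le_trans hv' hsmall)
    have hSv : 2 ^ (φ.manBits + 1 + g) ≤ s.scaledMag := by
      rw [show 2 ^ (φ.manBits + 1 + g) = 2 ^ φ.manBits * 2 ^ (g + 1) by ring, hsN]
      exact le_scaledMag_roundNE_of_representable_le hvrep hv'
    have hS2 : 2 ^ (g + 1) ∣ s.scaledMag :=
      Format.pow_dvd_of_representable s.representable_scaledMag
        (by rw [show φ.manBits + (g + 1) = φ.manBits + 1 + g by ring]; exact hSv)
    -- same signs throughout; range of S - A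
    have hZmax : (s.toInt - A).natAbs ≤ φ.maxScaled := by rw [hsign]; split <;> omega
    by_cases hj : g + 1 ≤ a.expCode - 1
    · -- a is a multiple of 2^(g+1) too: S - A = c · 2^(g+1) with c < 2^p
      have hA2 : ((2 ^ (g + 1) : ℕ) : ℤ) ∣ A := by
        apply Int.natCast_dvd.mpr; rw [hXA]
        exact dvd_trans (Nat.pow_dvd_pow 2 hj) (pow_ulpExp_dvd_scaledMag a)
      have hS2' : ((2 ^ (g + 1) : ℕ) : ℤ) ∣ s.toInt := by
        rw [hsign]; split
        · exact dvd_neg.mpr (Int.natCast_dvd_natCast.mpr hS2)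
        · exact Int.natCast_dvd_natCast.mpr hS2
      refine representable_of_pow_dvd (Int.natCast_dvd.mp (dvd_sub hS2' hA2)) ?_ hZmax
      have : (s.toInt - A).natAbs ≤ 2 * b.scaledMag := by omega
      calc (s.toInt - A).natAbs ≤ 2 * b.scaledMag := this
        _ ≤ 2 ^ (φ.manBits + 1 + (g + 1)) := by rw [show φ.manBits + 1 + (g + 1) = (φ.manBits + 1 + g) + 1 by ring, pow_succ]; omega
    · -- a and b share the ulp 2^g: |A|, |B| < 2^(p+g) ≤ |A + B| < 2^(p+g+1); half-spacing 2^g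
      have hjg : a.expCode - 1 = g := le_antisymm (by omega) (ulpExp_mono hab')
      have hAlt : a.scaledMag < 2 ^ (φ.manBits + 1 + g) := by rw [← hjg]; exact scaledMag_lt_pow_ulpExp a
      have hNhi : (A + B).natAbs < 2 ^ (φ.manBits + 1 + (g + 1)) := by
        rw [show φ.manBits + 1 + (g + 1) = (φ.manBits + 1 + g) + 1 by ring, pow_succ]; omega
      have hhalf := natAbs_sub_scaledMag_roundNE_le (φ := φ) hv hNhi hsmall
      rw [← hsN] at hhalf
      -- |B| ≤ 2^(p+g) - 2^g since 2^g ∣ |B| < 2^(p+g)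
      have hBle : b.scaledMag + 2 ^ g ≤ 2 ^ (φ.manBits + 1 + g) := by
        obtain ⟨c, hc⟩ := pow_ulpExp_dvd_scaledMag b
        rw [← hg] at hc
        have hc' : c < 2 ^ (φ.manBits + 1) := by
          by_contra hge
          have : 2 ^ g * 2 ^ (φ.manBits + 1) ≤ 2 ^ g * c := Nat.mul_le_mul_left _ (not_lt.mp hge)
          rw [← hc, ← pow_add, show g + (φ.manBits + 1) = φ.manBits + 1 + g by ring] at this
          omega
        calc b.scaledMag + 2 ^ g = 2 ^ g * (c + 1) := by rw [hc]; ring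
          _ ≤ 2 ^ g * 2 ^ (φ.manBits + 1) := Nat.mul_le_mul_left _ hc'
          _ = 2 ^ (φ.manBits + 1 + g) := by rw [← pow_add]; congr 1; ring
      refine representable_of_pow_dvd (Int.natCast_dvd.mp hZdvd) ?_ hZmax
      rw [hsign] at ⊢
      split <;> omega

/-! ### Fast2Sum -/

/-- FAST2SUM IS AN ERROR-FREE TRANSFORMATION IN EVERY MINIFLOAT FORMAT under saturating
round-to-nearest-even, with no range hypothesis: for data `|b| ≤ |a|`, `s = fl(a + b)`,
`z = fl(s - a)`, `t = fl(b - z)` satisfy `z = s - a` and `t = a + b - s` exactly.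
[cite: BoldoMelquiond2017, Thm 5.6; Dekker1971] -/
theorem fast2Sum_exact (a b : MiniFloat φ) (hab : |b.toRat| ≤ |a.toRat|) :
    let s := roundNE φ (a.toRat + b.toRat)
    let z := roundNE φ (s.toRat - a.toRat)
    let t := roundNE φ (b.toRat - z.toRat)
    z.toRat = s.toRat - a.toRat ∧ t.toRat = a.toRat + b.toRat - s.toRat := by
  intro s z t
  have hz : z.toRat = s.toRat - a.toRat := toRat_roundNE_of_exists (round_sub_representable a b hab)
  refine ⟨hz, ?_⟩
  show (roundNE φ (b.toRat - z.toRat)).toRat = _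
  rw [hz, show b.toRat - (s.toRat - a.toRat) = a.toRat + b.toRat - s.toRat by ring]
  exact toRat_roundNE_of_exists (addErr_representable a b)

/-- Fast2Sum in the Kahan/Neumaier operation order: with `|b| ≤ |a|` and `s = fl(a + b)`,
`fl(fl(a - s) + b) = a + b - s` exactly. [cite: BoldoMelquiond2017, Thm 5.6; Dekker1971] -/
theorem fast2Sum_exact' (a b : MiniFloat φ) (hab : |b.toRat| ≤ |a.toRat|) :
    (roundNE φ ((roundNE φ (a.toRat - (roundNE φ (a.toRat + b.toRat)).toRat)).toRat + b.toRat)).toRat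
      = a.toRat + b.toRat - (roundNE φ (a.toRat + b.toRat)).toRat := by
  set s := roundNE φ (a.toRat + b.toRat) with hs
  have h1 : (roundNE φ (a.toRat - s.toRat)).toRat = a.toRat - s.toRat := by
    obtain ⟨z, hz⟩ := round_sub_representable a b hab
    apply toRat_roundNE_of_exists
    exact ⟨z.flipSign, by rw [toRat_flipSign, hz]; ring⟩
  rw [h1, show a.toRat - s.toRat + b.toRat = a.toRat + b.toRat - s.toRat by ring]
  exact toRat_roundNE_of_exists (addErr_representable a b)

/-- Without the magnitude test Fast2Sum can fail (kernel, `E2M1`): `a = 1/2`, `b = 4` gives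
`s = fl(9/2) = 4`, `z = fl(4 - 1/2) = fl(7/2) = 4`, `t = fl(4 - 4) = 0 ≠ a + b - s = 1/2`; with the
operands ordered (`a = 4`, `b = 1/2`) the error `1/2` is recovered. [folklore] -/
theorem fast2Sum_E2M1_examples :
    (roundNE Format.E2M1 ((1 : ℚ) / 2 + 4)).toRat = 4 ∧
    (roundNE Format.E2M1 ((4 : ℚ) - (roundNE Format.E2M1 (4 - 1 / 2)).toRat)).toRat = 0 ∧
    (roundNE Format.E2M1 ((1 : ℚ) / 2 - (roundNE Format.E2M1 (4 - 4)).toRat)).toRat = 1 / 2 := by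
  decide +kernel

/-- Saturation is harmless (kernel, `E2M1`, `maxRat = 6`): `a = 4`, `b = 3`: `s = fl(7) = 6`,
`z = fl(6 - 4) = 2`, `t = fl(3 - 2) = 1 = a + b - s`. [folklore] -/
theorem fast2Sum_E2M1_saturation_example :
    (roundNE Format.E2M1 ((4 : ℚ) + 3)).toRat = 6 ∧
    (roundNE Format.E2M1 ((6 : ℚ) - 4)).toRat = 2 ∧ (roundNE Format.E2M1 ((3 : ℚ) - 2)).toRat = 1 := by
  decide +kernel

end MiniFloat

end Literature.ComputerArithmetic.FloatingPoint
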